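import Summits.Ventures.QEDPrecision.BubbleChains.LogPowerIntegrals

/-!
# The masters `J(k,q;ε) = ∫_ε^1 x^{−q} logᵏ(1−x) dx`: integrability, the by-parts recurrence, the `k = 0` values, `ε → 0⁺`

HONEST FRAMING: independent recomputation; certified where stated, statistical where stated; no new-physics claim.

Route D, step 2 (cell `pub-qed`, unit `pub-qed-lit`; used by `DoubleBubbleReduction.lean`). For `0 < ε < 1` the
masters with a pole at `x = 0` are reduced by integration by parts with the SUBTRACTED primitive
`(x^{−n} − 1) logᵏ(1−x)`, which vanishes at `x = 1`, so no boundary term at `1` appears: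
`master_recurrence`: `−n J(k,n+1;ε) = −(ε^{−n} − 1) logᵏ(1−ε) + k Σ_{i<n} J(k−1,i+1;ε)`
(the geometric identity `(1−x) Σ_{i<n} x^{−(i+1)} = x^{−n} − 1` turns `(x^{−n}−1)/(1−x)` into masters again).
The `k = 0` masters are elementary (`integral_zpow_neg_succ`, `integral_zpow_neg_one`), and
`tendsto_integral_left` (continuity of the primitive) passes to `ε → 0⁺` for integrands integrable on `[0,1]`.
All statements are folklore calculus, proved from Mathlib; no definitions.
-/

noncomputable section

open Real Set MeasureTheory intervalIntegral Filter Topology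

namespace Summit.Ventures.QEDPrecision.BubbleChains

/-- `x^m (log (1−x))^k` (`m : ℤ`) is integrable on `[ε,1]` for `0 < ε ≤ 1`. [folklore] -/
theorem intervalIntegrable_zpow_mul_log_one_sub_pow (m : ℤ) (k : ℕ) {ε : ℝ} (hε : 0 < ε) (hε1 : ε ≤
    1) :
    IntervalIntegrable (fun x : ℝ => x ^ m * log (1 - x) ^ k) volume ε 1 := by
  have h1 : IntervalIntegrable (fun x : ℝ => log (1 - x) ^ k) volume ε 1 :=
    (intervalIntegrable_log_one_sub_pow k).mono_set (by
      rw [uIcc_of_le zero_le_one, uIcc_of_le hε1]; exact Icc_subset_Icc hε.le le_rfl)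
  refine h1.continuousOn_mul ?_
  rw [uIcc_of_le hε1]
  intro x hx
  exact (continuousAt_zpow₀ x m (Or.inl (by linarith [hx.1] : x ≠ 0))).continuousWithinAt

/-- The geometric identity `(1−x) Σ_{i<n} x^{−(i+1)} = x^{−n} − 1` (`x ≠ 0`). [folklore] -/
theorem one_sub_mul_sum_zpow_neg (n : ℕ) {x : ℝ} (hx : x ≠ 0) :
    (1 - x) * ∑ i ∈ Finset.range n, x ^ (-((i:ℤ) + 1)) = x ^ (-(n:ℤ)) - 1 := by
  induction n with
  | zero => simp
  | succ n ih =>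
    rw [Finset.sum_range_succ, mul_add, ih]
    have e1 : x ^ (-((n:ℤ) + 1)) = x ^ (-(n:ℤ)) * x⁻¹ := by
      rw [show (-((n:ℤ) + 1)) = -(n:ℤ) + (-1) by ring, zpow_add₀ hx, zpow_neg_one]
    push_cast
    rw [e1]
    field_simp
    ring

/-- `1 − x → 0⁺` along `x → 1⁻`. [folklore] -/
theorem tendsto_one_sub_nhdsLT_one :
    Tendsto (fun x : ℝ => 1 - x) (𝓝[<] 1) (𝓝[>] 0) := by
  refine tendsto_nhdsWithin_iff.2 ⟨?_, ?_⟩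
  · have : Tendsto (fun x : ℝ => 1 - x) (𝓝 1) (𝓝 (1 - 1)) :=
      (continuous_const.sub continuous_id).tendsto 1
    simpa using tendsto_nhdsWithin_of_tendsto_nhds this
  · filter_upwards [self_mem_nhdsWithin] with x hx
    simp only [mem_Iio] at hx
    simp only [mem_Ioi]; linarith

/-- `(1−x) (log (1−x))^k → 0` as `x → 1⁻`. [folklore] -/
theorem tendsto_one_sub_mul_log_pow (k : ℕ) :
    Tendsto (fun x : ℝ => (1 - x) * log (1 - x) ^ k) (𝓝[<] 1) (𝓝 0) :=
  (tendsto_self_mul_log_pow k).comp tendsto_one_sub_nhdsLT_one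

/-- **Recurrence of the masters** (integration by parts with the subtracted primitive
`(x^{−n} − 1)(log (1−x))^k`, which vanishes at `x = 1`): for `0 < ε < 1`,
`−n ∫_ε^1 x^{−(n+1)} Lᵏ = −(ε^{−n} − 1) L(ε)ᵏ + k Σ_{i<n} ∫_ε^1 x^{−(i+1)} L^{k−1}`,
`L = log (1−x)`.
[folklore] -/
theorem master_recurrence (n k : ℕ) {ε : ℝ} (hε : 0 < ε) (hε1 : ε < 1) :
    -(n:ℝ) * ∫ x in ε..1, x ^ (-((n:ℤ) + 1)) * log (1 - x) ^ k
      = -((ε ^ (-(n:ℤ)) - 1) * log (1 - ε) ^ k)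
        + k * ∑ i ∈ Finset.range n, ∫ x in ε..1, x ^ (-((i:ℤ) + 1)) * log (1 - x) ^ (k - 1) := by
  have hI : ∀ (m : ℤ) (j : ℕ), IntervalIntegrable (fun x : ℝ => x ^ m * log (1 - x) ^ j) volume ε 1
      :=
    fun m j => intervalIntegrable_zpow_mul_log_one_sub_pow m j hε hε1.le
  have hS_int : IntervalIntegrable
      (fun x : ℝ => ∑ i ∈ Finset.range n, x ^ (-((i:ℤ) + 1)) * log (1 - x) ^ (k - 1)) volume ε 1 :=
          by
    have := IntervalIntegrable.sum (μ := volume) (a := ε) (b := 1) (Finset.range n)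
      (f := fun (i : ℕ) (x : ℝ) => x ^ (-((i:ℤ) + 1)) * log (1 - x) ^ (k - 1)) (fun i _ => hI _ _)
    have e : (∑ i ∈ Finset.range n, fun (x : ℝ) => x ^ (-((i:ℤ) + 1)) * log (1 - x) ^ (k - 1))
        = fun x : ℝ => ∑ i ∈ Finset.range n, x ^ (-((i:ℤ) + 1)) * log (1 - x) ^ (k - 1) := by
      funext x; simp only [Finset.sum_apply]
    rw [e] at this; exact this
  -- derivative of the subtracted primitive on (ε, 1)
  have hderiv : ∀ x ∈ Ioo ε 1, HasDerivAt (fun x : ℝ => (x ^ (-(n:ℤ)) - 1) * log (1 - x) ^ k)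
      (-(n:ℝ) * (x ^ (-((n:ℤ) + 1)) * log (1 - x) ^ k)
        - k * ∑ i ∈ Finset.range n, x ^ (-((i:ℤ) + 1)) * log (1 - x) ^ (k - 1)) x := by
    intro x hx
    have hx0 : x ≠ 0 := by linarith [hx.1]
    have hx1 : 1 - x ≠ 0 := by linarith [hx.2]
    have h1 : HasDerivAt (fun x : ℝ => x ^ (-(n:ℤ)) - 1) ((-(n:ℤ) : ℤ) * x ^ (-(n:ℤ) - 1)) x := by
      simpa using (hasDerivAt_zpow (-(n:ℤ)) x (Or.inl hx0)).sub_const 1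
    have h2 : HasDerivAt (fun x : ℝ => log (1 - x) ^ k)
        ((k:ℕ) * log (1 - x) ^ (k - 1) * (-1 / (1 - x))) x := by
      have hl : HasDerivAt (fun x : ℝ => log (1 - x)) (-1 / (1 - x)) x := by
        simpa using ((hasDerivAt_id x).const_sub 1).log hx1
      exact hl.pow k
    refine (h1.mul h2).congr_deriv ?_
    have e1 : x ^ (-(n:ℤ) - 1) = x ^ (-((n:ℤ) + 1)) := by congr 1; ring
    have e2 : (x ^ (-(n:ℤ)) - 1) * (-1 / (1 - x))
        = -∑ i ∈ Finset.range n, x ^ (-((i:ℤ) + 1)) := by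
      rw [← one_sub_mul_sum_zpow_neg n hx0]; field_simp
    have e3 : (x ^ (-(n:ℤ)) - 1) * ((k:ℕ) * log (1 - x) ^ (k - 1) * (-1 / (1 - x)))
        = (k:ℝ) * log (1 - x) ^ (k - 1) * ((x ^ (-(n:ℤ)) - 1) * (-1 / (1 - x))) := by
      ring
    rw [← Finset.sum_mul, e1, e3, e2]
    push_cast
    ring
  have hint : IntervalIntegrable (fun x : ℝ => -(n:ℝ) * (x ^ (-((n:ℤ) + 1)) * log (1 - x) ^ k)
      - k * ∑ i ∈ Finset.range n, x ^ (-((i:ℤ) + 1)) * log (1 - x) ^ (k - 1)) volume ε 1 :=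
    ((hI _ _).const_mul _).sub (hS_int.const_mul _)
  -- endpoint limits of the primitive
  have hε' : Tendsto (fun x : ℝ => (x ^ (-(n:ℤ)) - 1) * log (1 - x) ^ k) (𝓝[>] ε)
      (𝓝 ((ε ^ (-(n:ℤ)) - 1) * log (1 - ε) ^ k)) := by
    have hx0 : ε ≠ 0 := hε.ne'
    have hx1 : 1 - ε ≠ 0 := by linarith
    have hc : ContinuousAt (fun x : ℝ => (x ^ (-(n:ℤ)) - 1) * log (1 - x) ^ k) ε :=
      ((continuousAt_zpow₀ ε _ (Or.inl hx0)).sub continuousAt_const).mul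
        (((continuousAt_const.sub continuousAt_id).log hx1).pow k)
    exact tendsto_nhdsWithin_of_tendsto_nhds hc.tendsto
  have h1' : Tendsto (fun x : ℝ => (x ^ (-(n:ℤ)) - 1) * log (1 - x) ^ k) (𝓝[<] 1) (𝓝 0) := by
    have hS : Tendsto (fun x : ℝ => ∑ i ∈ Finset.range n, x ^ (-((i:ℤ) + 1))) (𝓝[<] 1)
        (𝓝 (∑ i ∈ Finset.range n, (1:ℝ) ^ (-((i:ℤ) + 1)))) := by
      apply tendsto_nhdsWithin_of_tendsto_nhds
      refine tendsto_finsetSum _ fun i _ => ?_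
      exact (continuousAt_zpow₀ (1:ℝ) _ (Or.inl one_ne_zero)).tendsto
    have h := hS.mul (tendsto_one_sub_mul_log_pow k)
    rw [mul_zero] at h
    refine h.congr' ?_
    filter_upwards [Ioo_mem_nhdsLT hε1] with x hx
    have hx0 : x ≠ 0 := by linarith [hx.1]
    rw [← one_sub_mul_sum_zpow_neg n hx0]; ring
  have hftc := integral_eq_sub_of_hasDerivAt_of_tendsto hε1 hderiv hint hε' h1'
  rw [intervalIntegral.integral_sub ((hI _ _).const_mul _) (hS_int.const_mul _),
    intervalIntegral.integral_const_mul, intervalIntegral.integral_const_mul,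
    intervalIntegral.integral_finsetSum (fun i _ => hI _ _)] at hftc
  linarith

/-! ## The `k = 0` masters and the limit `ε → 0⁺` -/

/-- `∫_ε^1 x^{−(n+1)} dx = (ε^{−n} − 1)/n` for `n ≥ 1`. [folklore] -/
theorem integral_zpow_neg_succ (n : ℕ) (hn : 0 < n) {ε : ℝ} (hε : 0 < ε) (hε1 : ε ≤ 1) :
    ∫ x in ε..1, x ^ (-((n:ℤ) + 1)) = (ε ^ (-(n:ℤ)) - 1) / n := by
  have h0 : (0:ℝ) ∉ uIcc ε 1 := by
    rw [uIcc_of_le hε1]; intro h; exact absurd h.1 (not_le.2 hε)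
  have hne : (-((n:ℤ) + 1)) ≠ -1 := by omega
  rw [integral_zpow (Or.inr ⟨hne, h0⟩)]
  have e : (-((n:ℤ) + 1) + 1) = -(n:ℤ) := by ring
  rw [e, one_zpow]
  have hn' : (n:ℝ) ≠ 0 := by exact_mod_cast hn.ne'
  have e2 : (((-((n:ℤ) + 1) : ℤ) : ℝ) + 1) = -(n:ℝ) := by push_cast; ring
  rw [e2]
  field_simp
  ring

/-- `∫_ε^1 x^{−1} dx = −log ε`. [folklore] -/
theorem integral_zpow_neg_one {ε : ℝ} (hε : 0 < ε) (hε1 : ε ≤ 1) :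
    ∫ x in ε..1, x ^ (-((0:ℤ) + 1)) = -log ε := by
  have h0 : (0:ℝ) ∉ uIcc ε 1 := by
    rw [uIcc_of_le hε1]; intro h; exact absurd h.1 (not_le.2 hε)
  have : (fun x : ℝ => x ^ (-((0:ℤ) + 1))) = fun x => x⁻¹ := by
    funext x; simp
  rw [this, integral_inv h0, one_div, log_inv]

/-- Continuity of `ε ↦ ∫_ε^1 f` at `0⁺` for `f` integrable on `[0,1]`. [folklore] -/
theorem tendsto_integral_left {f : ℝ → ℝ} (hf : IntervalIntegrable f volume 0 1) :
    Tendsto (fun ε => ∫ x in ε..1, f x) (𝓝[>] 0) (𝓝 (∫ x in (0:ℝ)..1, f x)) := by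
  have hc := intervalIntegral.continuousOn_primitive_interval' hf (a := 1) right_mem_uIcc
  have h0 : (0:ℝ) ∈ uIcc (0:ℝ) 1 := left_mem_uIcc
  have ht : Tendsto (fun ε => ∫ x in (1:ℝ)..ε, f x) (𝓝[uIcc 0 1] 0) (𝓝 (∫ x in (1:ℝ)..0, f x)) :=
    (hc 0 h0).tendsto
  have hmono : 𝓝[>] (0:ℝ) ≤ 𝓝[uIcc 0 1] 0 := by
    rw [uIcc_of_le zero_le_one, ← nhdsWithin_Ioo_eq_nhdsGT zero_lt_one]
    exact nhdsWithin_mono _ Ioo_subset_Icc_self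
  have := (ht.mono_left hmono).neg
  rw [integral_symm (0:ℝ) 1, neg_neg] at this
  refine this.congr fun ε => ?_
  rw [integral_symm (1:ℝ) ε]

end Summit.Ventures.QEDPrecision.BubbleChains

end
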